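import Literature.IUT.HodgeTheaters.DiscreteProfiniteConjugatesProofs
import Mathlib.Algebra.FreeAbelianGroup.Finsupp
import Mathlib.GroupTheory.Finiteness
import Mathlib.GroupTheory.Index
import Mathlib.GroupTheory.Schreier
import Mathlib.Data.ZMod.Basic
import HarnessLib

/-!
# [IUTchI] §2: free-group lemmas for Theorem 2.6 (b) — centralizers, separating characters, finite rank

Mochizuki, *Inter-universal Teichmüller theory I*, kurims manuscript (May 2020), §2, proof of Theorem 2.6,
nonabelian case, p. 57 [cite: Mochizuki2012, Thm 2.6 p.57]: "there exist elements `x, y ∈ H_G` that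
generate a free abelian subgroup of rank two `M ⊆ G^{ab}` such that the injection `M ↪ G^{ab}` splits.
Write `H_x, H_y ⊆ H_G` for the subgroups generated, respectively, by `x` and `y`".  The discrete
free-group facts this step rests on, PROVED here over Mathlib's `IsFreeGroup` (Nielsen–Schreier
available as `subgroupIsFreeOfIsFree`):

* `isCyclic_of_isFreeGroup_of_central` — a free group with a nontrivial central element is cyclic
  (a free basis with two letters `a ≠ b` would put the central element in `⟨a⟩ ∩ ⟨b⟩ = 1`, using
  Lemma 2.7 (iv) free case `isCyclic_of_isFreeGroup_of_comm` and the coordinate characters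
  `F → ℤ`); hence `exists_centralizer_eq_zpowers`: **centralizers of nontrivial elements of free groups
  are cyclic** (`Z_G(u) = ⟨r⟩`, the "`H_x`" of p. 57 up to roots);
* `exists_hom_ne_one_eq_one` — **separating characters**: if `a, b` have `ℤ`-independent images in the
  abelianization of a free group `K` (the conclusion of Lemma 2.7 (iii)), there is `f : K → ℤ` with
  `f(a) ≠ 0 = f(b)` (the splitting "`M ↪ G^{ab}`" is only needed in this weak form), via the
  coordinates `K^{ab} ≅ ℤ^{(X)}` and a non-vanishing `2 × 2` minor;
* `isFreeOfFiniteRank_of_fg`, `isFreeOfFiniteRank_subgroup_of_finiteIndex` — a finitely generated free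
  group, in particular a finite index subgroup of a free group of finite rank, is free of finite rank
  ("after replacing `G` by an appropriate finite index subgroup", p. 57).

Proof-only file (no definitions).
-/

namespace Literature.IUT.HodgeTheaters.FreeOrSurface

universe u

/-! ### Coordinate characters of a free group -/

/-- The coordinate character of a free group at a free generator `a`: `a ↦ 1`, other generators `↦ 0`
(values in `Multiplicative ℤ`). Its value at `of a` is `ofAdd 1`. [cite: Mochizuki2012, Thm 2.6 p.57] -/
theorem lift_coord_of_self {C : Type u} [Group C] [IsFreeGroup C] [DecidableEq (IsFreeGroup.Generators C)]
    (a : IsFreeGroup.Generators C) :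
    IsFreeGroup.lift (fun c => if c = a then Multiplicative.ofAdd (1 : ℤ) else 1) (IsFreeGroup.of a) =
      Multiplicative.ofAdd (1 : ℤ) := by
  simp

/-- … and its value at another generator is `1`. [cite: Mochizuki2012, Thm 2.6 p.57] -/
theorem lift_coord_of_ne {C : Type u} [Group C] [IsFreeGroup C] [DecidableEq (IsFreeGroup.Generators C)]
    {a b : IsFreeGroup.Generators C} (hab : b ≠ a) :
    IsFreeGroup.lift (fun c => if c = a then Multiplicative.ofAdd (1 : ℤ) else 1) (IsFreeGroup.of b) = 1 := by
  simp [hab]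

/-! ### A free group with nontrivial centre is cyclic; centralizers are cyclic -/

/-- In a free group, an element commuting with a free generator `a` (indeed any element `z` such that
`⟨z, a⟩` is commutative) is a power of `a`: `⟨z, a⟩` is free and abelian, hence cyclic `= ⟨w⟩`, and the
coordinate character at `a` shows `w = a^{±1}`. [cite: Mochizuki2012, Thm 2.6 p.57] -/
theorem mem_zpowers_of_of_comm {C : Type u} [Group C] [IsFreeGroup C] (z : C)
    (a : IsFreeGroup.Generators C) (hz : z * IsFreeGroup.of a = IsFreeGroup.of a * z) :
    z ∈ Subgroup.zpowers (IsFreeGroup.of a) := by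
  classical
  set A : Subgroup C := Subgroup.closure {z, IsFreeGroup.of a} with hA
  -- `A` is commutative (generated by two commuting elements) and free, hence cyclic
  have hcommA : ∀ p q : A, p * q = q * p := by
    have hI : IsMulCommutative A := Subgroup.isMulCommutative_closure (k := ({z, IsFreeGroup.of a} : Set C)) (by
      intro p hp q hq
      simp only [Set.mem_insert_iff, Set.mem_singleton_iff] at hp hq
      rcases hp with rfl | rfl <;> rcases hq with rfl | rfl
      · rfl
      · exact hz
      · exact hz.symm
      · rfl)
    exact isMulCommutative_iff.mp hI
  have hcyc : IsCyclic A := isCyclic_of_isFreeGroup_of_comm A hcommA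
  obtain ⟨w, hw⟩ := hcyc.exists_generator
  have hzA : z ∈ A := Subgroup.subset_closure (by simp)
  have haA : IsFreeGroup.of a ∈ A := Subgroup.subset_closure (by simp)
  obtain ⟨p, hp⟩ := hw ⟨z, hzA⟩
  obtain ⟨q, hq⟩ := hw ⟨IsFreeGroup.of a, haA⟩
  have hp' : (w : C) ^ p = z := by simpa using congrArg Subtype.val hp
  have hq' : (w : C) ^ q = IsFreeGroup.of a := by simpa using congrArg Subtype.val hq
  -- the coordinate character at `a`
  set φ : C →* Multiplicative ℤ :=
    IsFreeGroup.lift (fun c => if c = a then Multiplicative.ofAdd (1 : ℤ) else 1) with hφ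
  have hφa : φ (IsFreeGroup.of a) = Multiplicative.ofAdd (1 : ℤ) := lift_coord_of_self a
  have hq1 : q * Multiplicative.toAdd (φ w) = 1 := by
    have := congrArg (fun t => Multiplicative.toAdd (φ t)) hq'
    simp only [map_zpow, toAdd_zpow, hφa, toAdd_ofAdd, smul_eq_mul] at this
    exact this
  rcases Int.mul_eq_one_iff_eq_one_or_neg_one.mp hq1 with ⟨hq1', -⟩ | ⟨hq1', -⟩
  · rw [hq1', zpow_one] at hq'
    exact Subgroup.mem_zpowers_iff.mpr ⟨p, by rw [← hq', hp']⟩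
  · rw [hq1', zpow_neg, zpow_one] at hq'
    refine Subgroup.mem_zpowers_iff.mpr ⟨-p, ?_⟩
    rw [← hp', ← hq', inv_zpow', neg_neg]

/-- **A free group with a nontrivial central element is cyclic**: with two distinct free generators
`a ≠ b` a central `z` would lie in `⟨a⟩ ∩ ⟨b⟩ = 1`. [cite: Mochizuki2012, Thm 2.6 p.57] -/
theorem isCyclic_of_isFreeGroup_of_central (C : Type u) [Group C] [IsFreeGroup C] (z : C) (hz1 : z ≠ 1)
    (hz : ∀ c : C, z * c = c * z) : IsCyclic C := by
  classical
  -- at most one free generator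
  have hsub : Subsingleton (IsFreeGroup.Generators C) := by
    refine ⟨fun a b => by_contra fun hab => hz1 ?_⟩
    obtain ⟨i, hi⟩ := Subgroup.mem_zpowers_iff.mp (mem_zpowers_of_of_comm z a (hz _))
    obtain ⟨j, hj⟩ := Subgroup.mem_zpowers_iff.mp (mem_zpowers_of_of_comm z b (hz _))
    set φ : C →* Multiplicative ℤ :=
      IsFreeGroup.lift (fun c => if c = a then Multiplicative.ofAdd (1 : ℤ) else 1) with hφ
    have h1 : φ z = Multiplicative.ofAdd i := by
      rw [← hi, map_zpow, lift_coord_of_self, ← ofAdd_zsmul, smul_eq_mul, mul_one]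
    have h2 : φ z = 1 := by
      rw [← hj, map_zpow, lift_coord_of_ne (Ne.symm hab), one_zpow]
    have hi0 : i = 0 := by
      have := h1.symm.trans h2
      simpa using this
    rw [← hi, hi0, zpow_zero]
  -- hence every element commutes with every other
  refine isCyclic_of_isFreeGroup_of_comm C fun p q => ?_
  rcases isEmpty_or_nonempty (IsFreeGroup.Generators C) with hE | ⟨⟨a⟩⟩
  · -- no generators: the group is trivial
    have htriv : ∀ t : C, t = 1 := fun t => by
      have ht := (IsFreeGroup.toFreeGroup C).symm_apply_apply t
      rw [← ht]
      induction (IsFreeGroup.toFreeGroup C) t using FreeGroup.induction_on with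
      | C1 => simp
      | of c => exact isEmptyElim c
      | inv_of c _ => exact isEmptyElim c
      | mul r s hr hs => rw [map_mul, hr, hs, one_mul]
    rw [htriv p, htriv q, one_mul]
  · have hmem : ∀ t : C, t ∈ Subgroup.zpowers (IsFreeGroup.of a) := by
      intro t
      have ht := (IsFreeGroup.toFreeGroup C).symm_apply_apply t
      rw [← ht]
      induction (IsFreeGroup.toFreeGroup C) t using FreeGroup.induction_on with
      | C1 => simp
      | of c =>
        rw [Subsingleton.elim c a]
        have : (IsFreeGroup.toFreeGroup C).symm (FreeGroup.of a) = IsFreeGroup.of a := by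
          simp [IsFreeGroup.toFreeGroup, IsFreeGroup.of]
        rw [this]; exact Subgroup.mem_zpowers _
      | inv_of c hc => rw [map_inv]; exact Subgroup.inv_mem _ hc
      | mul r s hr hs => rw [map_mul]; exact Subgroup.mul_mem _ hr hs
    obtain ⟨i, hi⟩ := Subgroup.mem_zpowers_iff.mp (hmem p)
    obtain ⟨j, hj⟩ := Subgroup.mem_zpowers_iff.mp (hmem q)
    rw [← hi, ← hj]
    exact zpow_mul_comm _ i j

/-- **Centralizers in free groups are cyclic**: for `u ≠ 1` in a free group `K`, `Z_K(u) = ⟨r⟩` for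
some `r` (a root of `u`) — the subgroups "`H_x`", "`H_y`" of p. 57 sit in such centralizers.
[cite: Mochizuki2012, Thm 2.6 p.57] -/
theorem exists_centralizer_eq_zpowers (K : Type u) [Group K] [IsFreeGroup K] (u : K) (hu : u ≠ 1) :
    ∃ r : K, Subgroup.centralizer ({u} : Set K) = Subgroup.zpowers r := by
  set C : Subgroup K := Subgroup.centralizer ({u} : Set K) with hC
  have huC : u ∈ C := Subgroup.mem_centralizer_iff.mpr (by simp)
  have hcyc : IsCyclic C := by
    refine isCyclic_of_isFreeGroup_of_central C ⟨u, huC⟩ (fun h => hu (congrArg Subtype.val h)) ?_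
    intro c
    have := Subgroup.mem_centralizer_iff.mp c.2 u (by simp)
    exact Subtype.ext this
  obtain ⟨w, hw⟩ := hcyc.exists_generator
  refine ⟨w, le_antisymm (fun c hc => ?_) ?_⟩
  · obtain ⟨k, hk⟩ := hw ⟨c, hc⟩
    exact Subgroup.mem_zpowers_iff.mpr ⟨k, by simpa using congrArg Subtype.val hk⟩
  · rw [Subgroup.zpowers_le]; exact w.2

/-- If `u = r^p` has nontrivial image under a character `f`, so does `r`; if `v = s^q ≠ 1` (`s` of
infinite order) has trivial image, so does `s` — bookkeeping for the roots of p. 57. [cite: Mochizuki2012, Thm 2.6 p.57] -/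
theorem apply_root_ne_one {K : Type u} [Group K] (f : K →* Multiplicative ℤ) {u r : K} {p : ℤ}
    (hp : r ^ p = u) (hu : f u ≠ 1) : f r ≠ 1 := by
  intro h; apply hu; rw [← hp, map_zpow, h, one_zpow]

/-- Companion of `apply_root_ne_one`: `f(s^q) = 1` with `q ≠ 0` forces `f(s) = 1` in the torsion-free
group `ℤ`. [cite: Mochizuki2012, Thm 2.6 p.57] -/
theorem apply_root_eq_one {K : Type u} [Group K] (f : K →* Multiplicative ℤ) {v s : K} {q : ℤ}
    (hq : s ^ q = v) (hq0 : q ≠ 0) (hv : f v = 1) : f s = 1 := by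
  have h : q * Multiplicative.toAdd (f s) = 0 := by
    have := congrArg Multiplicative.toAdd (show f (s ^ q) = 1 by rw [hq, hv])
    simpa [map_zpow] using this
  rcases mul_eq_zero.mp h with h | h
  · exact absurd h hq0
  · exact toAdd_eq_zero.mp h

/-! ### Separating characters from independence in the abelianization -/

/-- **Separating characters.**  Let `K` be a free group and `a, b ∈ K` have `ℤ`-independent images in
`K^{ab}` (no nontrivial relation `ā^i b̄^j = 1` — the conclusion of Lemma 2.7 (iii)).  Then some
homomorphism `f : K → ℤ` has `f(a) ≠ 0` and `f(b) = 0`: in coordinates `K^{ab} ≅ ℤ^{(X)}` take a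
non-vanishing `2 × 2` minor of `(ā, b̄)`. [cite: Mochizuki2012, Thm 2.6 p.57] -/
theorem exists_hom_ne_one_eq_one (K : Type u) [Group K] [IsFreeGroup K] (a b : K)
    (hind : ∀ i j : ℤ, Abelianization.of a ^ i * Abelianization.of b ^ j = 1 → i = 0 ∧ j = 0) :
    ∃ f : K →* Multiplicative ℤ, f a ≠ 1 ∧ f b = 1 := by
  classical
  -- coordinates `K^{ab} ≅ ℤ^{(X)}`
  let X := IsFreeGroup.Generators K
  let E : Abelianization K ≃* Abelianization (FreeGroup X) := (IsFreeGroup.toFreeGroup K).abelianizationCongr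
  let ι : FreeAbelianGroup X ≃+ (X →₀ ℤ) := FreeAbelianGroup.equivFinsupp X
  -- the coordinate map as a homomorphism `K → Multiplicative (X →₀ ℤ)`
  let ψ : Abelianization (FreeGroup X) →* Multiplicative (X →₀ ℤ) :=
    AddMonoidHom.toMultiplicativeRight ι.toAddMonoidHom
  let coord : K →* Multiplicative (X →₀ ℤ) := ψ.comp (E.toMonoidHom.comp Abelianization.of)
  set a' : X →₀ ℤ := Multiplicative.toAdd (coord a) with ha'
  set b' : X →₀ ℤ := Multiplicative.toAdd (coord b) with hb'
  -- `ψ ∘ E` is injective, so independence transfers to `a', b'`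
  have hψinj : Function.Injective ψ := fun p q h => by
    have h' : Multiplicative.ofAdd (ι (Additive.ofMul p)) =
        Multiplicative.ofAdd (ι (Additive.ofMul q)) := h
    exact Additive.ofMul.injective (ι.injective (Multiplicative.ofAdd.injective h'))
  have hind' : ∀ i j : ℤ, i • a' + j • b' = 0 → i = 0 ∧ j = 0 := by
    intro i j h
    apply hind i j
    apply E.injective; apply hψinj
    rw [map_one, map_one]
    apply Multiplicative.toAdd.injective
    rw [map_mul, map_mul, map_zpow, map_zpow, map_zpow, map_zpow, toAdd_mul, toAdd_zpow, toAdd_zpow,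
      toAdd_one]
    exact h
  -- `b' ≠ 0`
  have hb0 : b' ≠ 0 := by
    intro h
    have := (hind' 0 1 (by rw [h]; simp)).2
    exact one_ne_zero this
  obtain ⟨q, hq⟩ : ∃ q, b' q ≠ 0 := by
    by_contra hnone
    apply hb0; ext q; by_contra hq; exact hnone ⟨q, hq⟩
  -- a non-vanishing minor
  set w : X →₀ ℤ := (b' q) • a' - (a' q) • b' with hw
  have hw0 : w ≠ 0 := by
    intro h
    have := (hind' (b' q) (-(a' q)) (by rw [neg_smul, ← sub_eq_add_neg, ← hw, h])).1
    exact hq this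
  obtain ⟨p, hp⟩ : ∃ p, w p ≠ 0 := by
    by_contra hnone
    apply hw0; ext p; by_contra hp; exact hnone ⟨p, hp⟩
  -- the functional `φ z = b'(q) z(p) - b'(p) z(q)`
  let φ : (X →₀ ℤ) →+ ℤ := (b' q) • Finsupp.applyAddHom p - (b' p) • Finsupp.applyAddHom q
  have hφb : φ b' = 0 := by
    simp only [φ, AddMonoidHom.sub_apply, AddMonoidHom.smul_apply, Finsupp.applyAddHom_apply,
      smul_eq_mul]
    ring
  have hφa : φ a' ≠ 0 := by
    have : φ a' = w p := by
      simp only [φ, hw, AddMonoidHom.sub_apply, AddMonoidHom.smul_apply, Finsupp.applyAddHom_apply,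
        smul_eq_mul, Finsupp.sub_apply, Finsupp.smul_apply]
      ring
    rw [this]; exact hp
  refine ⟨(AddMonoidHom.toMultiplicative φ).comp coord, ?_, ?_⟩
  · intro h
    apply hφa
    have := congrArg Multiplicative.toAdd h
    simpa [ha'] using this
  · apply Multiplicative.toAdd.injective
    simpa [hb'] using hφb

/-! ### Finite rank -/

/-- A free group of finite rank is finitely generated. [cite: Mochizuki2012, Thm 2.6 p.56] -/
theorem fg_of_isFreeOfFiniteRank (G : Type u) [Group G] (hG : IsFreeOfFiniteRank G) : Group.FG G := by
  obtain ⟨n, ⟨e⟩⟩ := hG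
  have hF : Group.FG (FreeGroup (Fin n)) := by
    refine (Group.fg_iff).mpr ⟨Set.range FreeGroup.of, ?_, Set.finite_range _⟩
    exact FreeGroup.closure_range_of _
  exact Group.fg_of_surjective (f := e.symm.toMonoidHom) (hG := hF) e.symm.surjective

/-- **A finitely generated free group is free of finite rank**: its free basis is finite (count the
homomorphisms to `ℤ/2`). [cite: Mochizuki2012, Thm 2.6 p.57] -/
theorem isFreeOfFiniteRank_of_fg (K : Type u) [Group K] [IsFreeGroup K] [hK : Group.FG K] :
    IsFreeOfFiniteRank K := by
  classical
  -- the basis is finite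
  have hfin : Finite (IsFreeGroup.Generators K) := by
    by_contra hinf
    rw [not_finite_iff_infinite] at hinf
    obtain ⟨S, hS⟩ := (Group.fg_iff.mp hK)
    obtain ⟨hSc, hSf⟩ := hS
    haveI : Finite S := hSf.to_subtype
    -- homomorphisms to `ℤ/2` are determined on `S`, hence finitely many
    have hfinHom : Finite (K →* Multiplicative (ZMod 2)) := by
      refine Finite.of_injective (fun f : K →* Multiplicative (ZMod 2) => fun s : S => f s) ?_
      intro f g h
      exact MonoidHom.eq_of_eqOn_dense hSc fun s hs => congrFun h ⟨s, hs⟩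
    -- but they correspond to arbitrary maps from the (infinite) basis
    have hinfHom : Infinite (K →* Multiplicative (ZMod 2)) :=
      Infinite.of_injective (fun v => IsFreeGroup.lift v) (IsFreeGroup.lift (G := K)).injective
    exact hinfHom.not_finite hfinHom
  obtain ⟨n, ⟨e⟩⟩ := Finite.exists_equiv_fin (IsFreeGroup.Generators K)
  exact ⟨n, ⟨(IsFreeGroup.toFreeGroup K).trans (FreeGroup.freeGroupCongr e)⟩⟩

/-- A finite index subgroup of a free group of finite rank is free of finite rank ("after replacing
`G` by an appropriate finite index subgroup of `G`", p. 57). [cite: Mochizuki2012, Thm 2.6 p.57] -/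
theorem isFreeOfFiniteRank_subgroup_of_finiteIndex (G : Type u) [Group G] (hG : IsFreeOfFiniteRank G)
    (K : Subgroup G) [K.FiniteIndex] : IsFreeOfFiniteRank K := by
  haveI := isFreeGroup_of_isFreeOfFiniteRank hG
  haveI := fg_of_isFreeOfFiniteRank G hG
  haveI : Group.FG K := Subgroup.fg_of_index_ne_zero K
  exact isFreeOfFiniteRank_of_fg K

end Literature.IUT.HodgeTheaters.FreeOrSurface
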